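import Mathlib

/-!
# T5CartanCoordinates — the radial substitution `r = tanh t` on the unit disc: the Poincaré
density in Cartan coordinates is `sinh t cosh t = ½ sinh 2t`, kernel-checked

Support for `route/T5-N4-p5.md` (sub-step N4.3 = (R3)), steps (N4.3.P1)/(N4.3.P2′)/(N4.3.P3): the
convergence integrals there are taken against the Haar measure of `H_j¹ = SU(1,1)` in Cartan
coordinates — Rühl's `½ sinh η dη (4π)⁻² dψ₁ dψ₂` (R3.10), i.e. the density `sinh(2t) dt` on `K\G/K`
used in `T5CoshIntegral.epsilon_bound_integral` (`∫₀^∞ cosh(t)^{ε−6} sinh(2t) dt`).  On the disc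
`𝔻 = G/K` the orbit of `0` under `k(θ) a_t` is `e^{2iθ} tanh t` (`T5PoincareDensity.mobius_cartan_zero`),
so the Cartan coordinate `t ≥ 0` is the radial substitution `r = tanh t`, `r ∈ (0, 1)`.  This file
supplies that substitution as a CHANGE-OF-VARIABLES THEOREM (no integrability hypothesis — Mathlib's
`integral_image_eq_integral_abs_deriv_smul`):

* `hasDerivAt_tanh` (`tanh′ = 1/cosh²`), `one_sub_tanh_sq` (`1 − tanh² = 1/cosh²`),
  `tanh_log_div_two` (the inverse `arctanh r = ½ log((1+r)/(1−r))`), `tanh_image_Ioi`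
  (`tanh '' (0,∞) = (0,1)`);
* `integral_Ioo_eq_integral_tanh`: for every `G : ℝ → E`,
  `∫_{(0,1)} r (1 − r²)⁻² • G r dr = ∫_{(0,∞)} (sinh t cosh t) • G (tanh t) dt` — the radial part of
  the Poincaré measure `r dr dθ/(1 − r²)²` becomes `sinh t cosh t dt = ½ sinh(2t) dt` in the Cartan
  coordinate (`integral_Ioo_eq_integral_sinh_two_mul`; with Rühl's `η = 2t`: `¼ sinh η dη`).

* `integral_ball_eq_integral_cartan`: the two-dimensional form on the disc — for every `F : ℂ → E`,
  `∫_{𝔻} (1 − ‖z‖²)⁻² • F z dA(z) = ∫_{(0,∞) × (−π,π)} (sinh t cosh t) • F (tanh t · e^{iθ}) dt dθ`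
  (Mathlib's polar coordinates `Complex.integral_comp_polarCoord_symm` followed by the
  two-dimensional change of variables `(t, θ) ↦ (tanh t, θ)`, Jacobian `1/cosh² t`):
  the Poincaré measure of `𝔻 = G/K` in the Cartan coordinates `(t, θ)` IS `sinh t cosh t dt dθ`.

Honest scope: the MEASURE statement «the pushforward of Haar measure on `G` to `G/K` is a multiple of
the Poincaré measure» (uniqueness of invariant measures) and the Haar measure on `G` itself are NOT
formalised; what is kernel-checked is that the Poincaré measure, the `SU(1,1)`-invariant measure of
`T5PoincareDensity.density_invariance`, has the density `sinh t cosh t = ½ sinh 2t` in the Cartan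
coordinate.
-/

noncomputable section

namespace Summit.Ventures.HodgeRepro2.T5CartanCoordinates

open MeasureTheory Set

/-- `tanh′ t = 1 / cosh² t`. -/
theorem hasDerivAt_tanh (t : ℝ) : HasDerivAt Real.tanh (1 / Real.cosh t ^ 2) t := by
  have h : Real.tanh = Real.sinh / Real.cosh := by
    funext x; exact Real.tanh_eq_sinh_div_cosh x
  rw [h]
  refine ((Real.hasDerivAt_sinh t).div (Real.hasDerivAt_cosh t) (Real.cosh_pos t).ne').congr_deriv ?_
  have := Real.cosh_sq_sub_sinh_sq t
  congr 1
  linear_combination this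

/-- `1 − tanh² t = 1 / cosh² t`. -/
theorem one_sub_tanh_sq (t : ℝ) : 1 - Real.tanh t ^ 2 = 1 / Real.cosh t ^ 2 := by
  have hc : Real.cosh t ^ 2 ≠ 0 := pow_ne_zero 2 (Real.cosh_pos t).ne'
  rw [Real.tanh_eq_sinh_div_cosh, div_pow, eq_div_iff hc, sub_mul, div_mul_cancel₀ _ hc, one_mul]
  linear_combination Real.cosh_sq_sub_sinh_sq t

/-- `tanh t > 0` for `t > 0`. -/
theorem tanh_pos_of_pos {t : ℝ} (ht : 0 < t) : 0 < Real.tanh t := by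
  rw [Real.tanh_eq_sinh_div_cosh]
  exact div_pos (Real.sinh_pos_iff.mpr ht) (Real.cosh_pos t)

/-- The inverse of `tanh` on `(0, 1)`: `tanh (½ log ((1 + r)/(1 − r))) = r`. -/
theorem tanh_log_div_two {r : ℝ} (h0 : 0 < r) (h1 : r < 1) :
    Real.tanh (Real.log ((1 + r) / (1 - r)) / 2) = r := by
  have hr1 : 0 < 1 - r := by linarith
  have hqpos : 0 < (1 + r) / (1 - r) := div_pos (by linarith) hr1
  set t := Real.log ((1 + r) / (1 - r)) / 2 with ht
  have e2 : Real.exp t * Real.exp t = (1 + r) / (1 - r) := by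
    rw [← Real.exp_add, ht, show Real.log ((1 + r) / (1 - r)) / 2 +
      Real.log ((1 + r) / (1 - r)) / 2 = Real.log ((1 + r) / (1 - r)) by ring, Real.exp_log hqpos]
  have eneg : Real.exp (-t) = (Real.exp t)⁻¹ := Real.exp_neg t
  have hE : Real.exp t ≠ 0 := (Real.exp_pos t).ne'
  have key : Real.tanh t = (Real.exp t * Real.exp t - 1) / (Real.exp t * Real.exp t + 1) := by
    rw [Real.tanh_eq_sinh_div_cosh, Real.sinh_eq, Real.cosh_eq, eneg]
    field_simp
  rw [key, e2, div_eq_iff (by positivity)]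
  field_simp
  ring

/-- `tanh` maps `(0, ∞)` onto `(0, 1)`. -/
theorem tanh_image_Ioi : Real.tanh '' Ioi (0 : ℝ) = Ioo 0 1 := by
  ext r
  constructor
  · rintro ⟨t, ht, rfl⟩
    exact ⟨tanh_pos_of_pos ht, Real.tanh_lt_one t⟩
  · rintro ⟨h0, h1⟩
    refine ⟨Real.log ((1 + r) / (1 - r)) / 2, ?_, tanh_log_div_two h0 h1⟩
    have hq : 1 < (1 + r) / (1 - r) := by
      rw [one_lt_div (by linarith)]; linarith
    have := Real.log_pos hq
    show 0 < Real.log ((1 + r) / (1 - r)) / 2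
    positivity

variable {E : Type*} [NormedAddCommGroup E] [NormedSpace ℝ E]

/-- THE RADIAL SUBSTITUTION `r = tanh t` FOR THE POINCARÉ DENSITY:
`∫_{(0,1)} r (1 − r²)⁻² • G r dr = ∫_{(0,∞)} (sinh t cosh t) • G (tanh t) dt` for every `G`. -/
theorem integral_Ioo_eq_integral_tanh (G : ℝ → E) :
    ∫ r in Ioo (0 : ℝ) 1, (r / (1 - r ^ 2) ^ 2) • G r =
      ∫ t in Ioi (0 : ℝ), (Real.sinh t * Real.cosh t) • G (Real.tanh t) := by
  rw [← tanh_image_Ioi]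
  rw [integral_image_eq_integral_abs_deriv_smul (f' := fun t => 1 / Real.cosh t ^ 2)
    measurableSet_Ioi (fun t _ => (hasDerivAt_tanh t).hasDerivWithinAt)
    Real.tanh_injective.injOn]
  refine setIntegral_congr_fun measurableSet_Ioi (fun t _ => ?_)
  rw [smul_smul]
  congr 1
  have hc : Real.cosh t ≠ 0 := (Real.cosh_pos t).ne'
  rw [one_sub_tanh_sq, abs_of_pos (by positivity), Real.tanh_eq_sinh_div_cosh]
  field_simp

/-- The same with `sinh t cosh t = ½ sinh 2t` — the density `sinh(2t) dt` of the text, up to the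
factor `½`. -/
theorem integral_Ioo_eq_integral_sinh_two_mul (G : ℝ → E) :
    ∫ r in Ioo (0 : ℝ) 1, (r / (1 - r ^ 2) ^ 2) • G r =
      ∫ t in Ioi (0 : ℝ), (Real.sinh (2 * t) / 2) • G (Real.tanh t) := by
  rw [integral_Ioo_eq_integral_tanh]
  refine setIntegral_congr_fun measurableSet_Ioi (fun t _ => ?_)
  congr 1
  rw [Real.sinh_two_mul]; ring

/-- The real-valued form. -/
theorem integral_Ioo_eq_integral_tanh_real (G : ℝ → ℝ) :
    ∫ r in Ioo (0 : ℝ) 1, r / (1 - r ^ 2) ^ 2 * G r =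
      ∫ t in Ioi (0 : ℝ), Real.sinh t * Real.cosh t * G (Real.tanh t) := by
  have := integral_Ioo_eq_integral_tanh (E := ℝ) G
  simpa only [smul_eq_mul] using this

/-- The determinant of the Jacobian of `(t, θ) ↦ (tanh t, θ)`: `1 / cosh² t`. -/
theorem det_cartanJacobian (p : ℝ × ℝ) :
    ((ContinuousLinearMap.toSpanSingleton ℝ (1 / Real.cosh p.1 ^ 2)).prodMap
      (ContinuousLinearMap.id ℝ ℝ)).det = 1 / Real.cosh p.1 ^ 2 := by
  simp only [ContinuousLinearMap.det, ContinuousLinearMap.coe_prodMap, ContinuousLinearMap.coe_id,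
    LinearMap.det_prodMap, LinearMap.det_ring, LinearMap.id_apply, mul_one,
    ContinuousLinearMap.coe_coe, ContinuousLinearMap.toSpanSingleton_apply, one_smul]

/-- `(t, θ) ↦ (tanh t, θ)` maps `(0,∞) × (−π, π)` onto `(0,1) × (−π, π)`. -/
theorem prodMap_tanh_image :
    Prod.map Real.tanh (id : ℝ → ℝ) '' (Ioi (0 : ℝ) ×ˢ Ioo (-Real.pi) Real.pi) =
      Ioo (0 : ℝ) 1 ×ˢ Ioo (-Real.pi) Real.pi := by
  rw [Set.prodMap_image_prod, tanh_image_Ioi, Set.image_id]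

/-- The polar-coordinate integrand of the Poincaré measure on the disc, on the polar target set
`(0,∞) × (−π, π)`: `r • 𝟙_𝔻(r e^{iθ}) (1 − r²)⁻² • F(r e^{iθ}) = 𝟙_{(0,1)×(−π,π)}(r, θ) · (r/(1 − r²)²) • F(r e^{iθ})`. -/
theorem polar_integrand_eq (F : ℂ → E) {p : ℝ × ℝ} (hp : p ∈ Ioi (0 : ℝ) ×ˢ Ioo (-Real.pi) Real.pi) :
    p.1 • (Metric.ball (0 : ℂ) 1).indicator (fun z => (1 / (1 - ‖z‖ ^ 2) ^ 2) • F z)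
        (Complex.polarCoord.symm p) =
      (Ioo (0 : ℝ) 1 ×ˢ Ioo (-Real.pi) Real.pi).indicator
        (fun q => (q.1 / (1 - q.1 ^ 2) ^ 2) •
          F (q.1 * (Real.cos q.2 + Real.sin q.2 * Complex.I))) p := by
  have hp1 : 0 < p.1 := hp.1
  have hnorm : ‖(Complex.polarCoord.symm p : ℂ)‖ = p.1 := by
    rw [Complex.polarCoord_symm_apply, norm_mul, Complex.ofReal_cos, Complex.ofReal_sin,
      Complex.norm_cos_add_sin_mul_I, mul_one, Complex.norm_real, Real.norm_eq_abs, abs_of_pos hp1]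
  have hmem : Complex.polarCoord.symm p ∈ Metric.ball (0 : ℂ) 1 ↔ p.1 < 1 := by
    rw [Metric.mem_ball, dist_zero_right, hnorm]
  by_cases h1 : p.1 < 1
  · have hmem' : p ∈ Ioo (0 : ℝ) 1 ×ˢ Ioo (-Real.pi) Real.pi := ⟨⟨hp1, h1⟩, hp.2⟩
    rw [Set.indicator_of_mem (hmem.mpr h1), Set.indicator_of_mem hmem', smul_smul, hnorm,
      Complex.polarCoord_symm_apply]
    congr 1
    ring
  · rw [Set.indicator_of_notMem (fun h => h1 (hmem.mp h)), smul_zero,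
      Set.indicator_of_notMem (fun h => h1 h.1.2)]

/-- THE POINCARÉ MEASURE OF THE DISC IN CARTAN COORDINATES: for every `F : ℂ → E`,
`∫_{𝔻} (1 − ‖z‖²)⁻² • F z dA(z) = ∫_{(0,∞) × (−π,π)} (sinh t cosh t) • F (tanh t · e^{iθ}) dt dθ`. -/
theorem integral_ball_eq_integral_cartan (F : ℂ → E) :
    ∫ z in Metric.ball (0 : ℂ) 1, (1 / (1 - ‖z‖ ^ 2) ^ 2) • F z =
      ∫ p in Ioi (0 : ℝ) ×ˢ Ioo (-Real.pi) Real.pi,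
        (Real.sinh p.1 * Real.cosh p.1) •
          F (Real.tanh p.1 * (Real.cos p.2 + Real.sin p.2 * Complex.I)) := by
  have hT : MeasurableSet (Ioi (0 : ℝ) ×ˢ Ioo (-Real.pi) Real.pi) :=
    measurableSet_Ioi.prod measurableSet_Ioo
  rw [← integral_indicator Metric.isOpen_ball.measurableSet,
    ← Complex.integral_comp_polarCoord_symm, polarCoord_target,
    setIntegral_congr_fun hT (fun p hp => polar_integrand_eq F hp),
    setIntegral_indicator (measurableSet_Ioo.prod measurableSet_Ioo),
    Set.inter_eq_right.mpr (Set.prod_mono Set.Ioo_subset_Ioi_self le_rfl),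
    ← prodMap_tanh_image,
    integral_image_eq_integral_abs_det_fderiv_smul volume hT
      (fun p _ => ((hasDerivAt_tanh p.1).hasFDerivAt.prodMap p (hasFDerivAt_id p.2)).hasFDerivWithinAt)
      (Real.tanh_injective.prodMap Function.injective_id).injOn]
  refine setIntegral_congr_fun hT (fun p _ => ?_)
  rw [det_cartanJacobian, smul_smul]
  simp only [Prod.map_fst, Prod.map_snd, id_eq]
  congr 1
  have hc : Real.cosh p.1 ≠ 0 := (Real.cosh_pos p.1).ne'
  rw [one_sub_tanh_sq, abs_of_pos (by positivity), Real.tanh_eq_sinh_div_cosh]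
  field_simp

end Summit.Ventures.HodgeRepro2.T5CartanCoordinates

end
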